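import Summits.ValiantsHypothesis.ValiantsHypothesis.Theorems.LacunarySymmetroidMatrixDescartesDoorA26WallBubblingThreePairNondeg
import Summits.ValiantsHypothesis.ValiantsHypothesis.Theorems.LacunarySymmetroidMatrixDescartesDoorA26WallBubblingThreePairCount
import Summits.ValiantsHypothesis.ValiantsHypothesis.Theorems.LacunarySymmetroidMatrixDescartesDoorA26WallBubblingWeylGenericSingleCluster

/-!
# Wall bubbling for `DoorA26` — THREE WEYL PAIRS: the three-pair limit of a cluster and the DOOR-FREE single-cluster branch

HONEST FRAMING.  Obligation (W) `stub_weylFaces` of `Cruxes/DoorA26/Lines/wall_bubbling.lean` (crux `DoorA26`, stmt-ValiantsHypothesis-19979;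
OPEN, typed, never asserted); statement file `Cruxes/DoorA26/Lines/wall_bubbling_ConfluentDoor.lean` rev 4, stratum `Stmt.weylFaces_deepVal` with
THREE Weyl pairs (`δ₀ = δ₅`, `δ₁ = δ₄`, `δ₂ = δ₃`, three value-generic values).  W1 seat val-sym-door-p2 g13 (#33); the three-pair companion of
W1 #27/#28 (def-free):

* `threePairLimit` — for ANY sequence of genuine `(2,6)` pencils whose exponents converge to a three-Weyl-pair point (no hypothesis on the three
  values): along a subsequence, after scalar normalisation, C^∞ convergence to the three-pair confluent determinant
  `det(e^{δ₀t}(W₀ + tW₅) + e^{δ₁t}(W₁ + tW₄) + e^{δ₂t}(W₂ + tW₃))` of a SYMMETRIC frame `W` with a non-zero polar Gram entry (Gram normalisation of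
  the three-dslope frame of W1 #31, `levelSelection_multi`, closedness of `Realisable`);
* **`no_twenty_window_threeWeylPairs`** — twenty zeros in a fixed window along such a sequence are impossible at a VALUE-GENERIC three-pair point,
  UNCONDITIONALLY (non-degeneracy W1 #32 + `multiplicity_transfer_iteratedDeriv` + the COUNT W1 #30: `≤ 17`);
* `no_boundedRatio_twenties_threeWeylPairs` — `x`-currency: no bounded-ratio twenties near such a point.

The multi-cluster case is the shared (W-split) middle.  Registers unchanged; (W), `ConfluentDoor26`, `DoorA26`, `MatrixDescartes`
(stmt-ValiantsHypothesis-18050) OPEN; nothing on VP ≠ VNP.  `--supports stmt-ValiantsHypothesis-19979 --as helper`.  [this work] the assembly.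
-/

-- `Summit.ValiantsHypothesis.ValiantsHypothesis.…` repeats a component by the D-0017 layout
-- (single-conjunct summit), which the `dupNamespace` linter flags; the name is mandated.
set_option linter.dupNamespace false

namespace Summit.ValiantsHypothesis.ValiantsHypothesis.Theorems.LacunarySymmetroidMatrixDescartes.WallBubbling

open Finset Filter Topology Polynomial
open Bubbling (polar Realisable polar_comm polar_self det_sum_smul_fin_two realisable_polarGram realisable_smul realisable_of_tendsto
  threePair_count_conclusion)
open scoped BigOperators

/-! ## 1. The three-pair limit of a cluster -/

/-- **THE THREE-PAIR LIMIT OF A CLUSTER.**  Pairs at `0,5` / `1,4` / `2,3` (`δ^ν₅ → δ0 0`, `δ^ν₄ → δ0 1`, `δ^ν₃ → δ0 2`). [this work] -/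
theorem threePairLimit (δs : ℕ → Fin 6 → ℝ) (δ0 : Fin 6 → ℝ)
    (hδ : ∀ l, Tendsto (fun ν => δs ν l) atTop (𝓝 (δ0 l))) (h50 : δ0 5 = δ0 0) (h41 : δ0 4 = δ0 1) (h32 : δ0 3 = δ0 2)
    (U : ℕ → Fin 6 → Matrix (Fin 2) (Fin 2) ℝ) (hU : ∀ ν l, (U ν l).IsSymm)
    (hne : ∀ ν, ∃ t, (∑ l, Real.exp (δs ν l * t) • U ν l).det ≠ 0) :
    ∃ φ : ℕ → ℕ, StrictMono φ ∧
    ∃ (a : ℕ → ℝ) (W : Fin 6 → Matrix (Fin 2) (Fin 2) ℝ),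
      (∀ l, (W l).IsSymm) ∧ (∃ p q, polar (W p) (W q) ≠ 0) ∧
      ∀ (n : ℕ) (ψ : ℕ → ℕ), StrictMono ψ → ∀ (ts : ℕ → ℝ) (t₀ : ℝ), Tendsto ts atTop (𝓝 t₀) →
        Tendsto (fun k => iteratedDeriv n (fun t => a (ψ k) * (∑ l, Real.exp (δs (φ (ψ k)) l * t) • U (φ (ψ k)) l).det) (ts k))
          atTop (𝓝 (iteratedDeriv n
            (fun t => ((Real.exp (δ0 0 * t)) • (W 0 + t • W 5) + (Real.exp (δ0 1 * t)) • (W 1 + t • W 4)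
              + (Real.exp (δ0 2 * t)) • (W 2 + t • W 3)).det) t₀)) := by
  classical
  set V : ℕ → Fin 6 → Matrix (Fin 2) (Fin 2) ℝ := fun ν l =>
    if l = 0 then U ν 0 + U ν 5 else if l = 1 then U ν 1 + U ν 4 else if l = 2 then U ν 2 + U ν 3
      else if l = 3 then (δs ν 3 - δs ν 2) • U ν 3 else if l = 4 then (δs ν 4 - δs ν 1) • U ν 4 else (δs ν 5 - δs ν 0) • U ν 5 with hV
  set M : ℕ → Fin 6 × Fin 6 → ℝ := fun ν pq => polar (V ν pq.1) (V ν pq.2) with hM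
  set μ : ℕ → ℝ := fun ν => (univ : Finset (Fin 6 × Fin 6)).sup' (Finset.univ_nonempty) (fun pq => |M ν pq|) with hμ
  have hdom : ∀ ν pq, |M ν pq| ≤ μ ν := fun ν pq => Finset.le_sup' (fun pq => |M ν pq|) (Finset.mem_univ pq)
  have hatt : ∀ ν, ∃ pq, |M ν pq| = μ ν := by
    intro ν
    obtain ⟨pq, _, hpq⟩ := Finset.exists_mem_eq_sup' (Finset.univ_nonempty (α := Fin 6 × Fin 6)) (fun pq => |M ν pq|)
    exact ⟨pq, hpq.symm⟩
  set c : ℕ → Fin 6 → ℝ → ℝ := fun ν p t =>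
    if p = 5 then dslope (fun y : ℝ => Real.exp (y * t)) (δs ν 0) (δs ν 5)
      else if p = 4 then dslope (fun y : ℝ => Real.exp (y * t)) (δs ν 1) (δs ν 4)
      else if p = 3 then dslope (fun y : ℝ => Real.exp (y * t)) (δs ν 2) (δs ν 3) else Real.exp (δs ν p * t) with hc
  set c₀ : Fin 6 → ℝ → ℝ := fun p t =>
    if p = 5 then dslope (fun y : ℝ => Real.exp (y * t)) (δ0 0) (δ0 0)
      else if p = 4 then dslope (fun y : ℝ => Real.exp (y * t)) (δ0 1) (δ0 1)
      else if p = 3 then dslope (fun y : ℝ => Real.exp (y * t)) (δ0 2) (δ0 2) else Real.exp (δ0 p * t) with hc₀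
  have hframe : ∀ ν t, (∑ l, Real.exp (δs ν l * t) • U ν l).det = ∑ p, ∑ q, M ν (p, q) * (c ν p t * c ν q t) := by
    intro ν t
    rw [frame_det₃]
  have hμpos : ∀ ν, 0 < μ ν := by
    intro ν
    obtain ⟨t, ht⟩ := hne ν
    rw [hframe ν t] at ht
    obtain ⟨p, _, hp⟩ := Finset.exists_ne_zero_of_sum_ne_zero ht
    obtain ⟨q, _, hq⟩ := Finset.exists_ne_zero_of_sum_ne_zero hp
    have hM0 : M ν (p, q) ≠ 0 := fun h => hq (by rw [h, zero_mul])
    exact lt_of_lt_of_le (abs_pos.mpr hM0) (hdom ν (p, q))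
  obtain ⟨φ, hφ, cl, hcl, -, hcl1⟩ := levelSelection_multi M μ hμpos hdom hatt
  have hreal : Realisable (Matrix.of fun p q => cl (p, q)) := by
    refine realisable_of_tendsto (Gseq := fun k => (μ (φ k))⁻¹ • Matrix.of fun p q => M (φ k) (p, q)) ?_ ?_
    · intro k
      exact realisable_smul _ (realisable_polarGram (V (φ k)) (fun l => frame_isSymm₃ (δs (φ k)) (U (φ k)) (hU (φ k)) l))
    · refine tendsto_pi_nhds.mpr fun p => tendsto_pi_nhds.mpr fun q => ?_
      have := hcl (p, q)
      simp only [Matrix.smul_apply, Matrix.of_apply, smul_eq_mul]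
      simpa [div_eq_inv_mul] using this
  obtain ⟨ε, W, hε, hW, hGW⟩ := hreal
  have hε2 : ε * ε = 1 := by rcases hε with rfl | rfl <;> norm_num
  have hcW : ∀ p q, ε * cl (p, q) = polar (W p) (W q) := by
    intro p q
    have := hGW p q
    simp only [Matrix.of_apply] at this
    rw [this, ← mul_assoc, hε2, one_mul]
  have hWne : ∃ p q, polar (W p) (W q) ≠ 0 := by
    obtain ⟨⟨p, q⟩, hpq⟩ := hcl1
    refine ⟨p, q, ?_⟩
    rw [← hcW]
    intro h
    rcases mul_eq_zero.mp h with h1 | h1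
    · rcases hε with rfl | rfl <;> norm_num at h1
    · rw [h1, abs_zero] at hpq; norm_num at hpq
  refine ⟨φ, hφ, fun k => ε * (μ (φ k))⁻¹, W, hW, hWne, ?_⟩
  intro n ψ hψ ts t₀ hts
  have hφψ : Tendsto (fun k => φ (ψ k)) atTop atTop := hφ.tendsto_atTop.comp hψ.tendsto_atTop
  have happrox : ∀ k, (fun t => ε * (μ (φ (ψ k)))⁻¹ * (∑ l, Real.exp (δs (φ (ψ k)) l * t) • U (φ (ψ k)) l).det)
      = fun t => ∑ p, ∑ q, (ε * (M (φ (ψ k)) (p, q) / μ (φ (ψ k)))) * (c (φ (ψ k)) p t * c (φ (ψ k)) q t) := by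
    intro k; funext t
    rw [hframe, Finset.mul_sum]
    refine Finset.sum_congr rfl fun p _ => ?_
    rw [Finset.mul_sum]
    refine Finset.sum_congr rfl fun q _ => ?_
    rw [div_eq_mul_inv]; ring
  have hlimit : (fun t => ((Real.exp (δ0 0 * t)) • (W 0 + t • W 5) + (Real.exp (δ0 1 * t)) • (W 1 + t • W 4)
        + (Real.exp (δ0 2 * t)) • (W 2 + t • W 3)).det)
      = fun t => ∑ p, ∑ q, polar (W p) (W q) * (c₀ p t * c₀ q t) := by
    funext t; exact threePairDet_eq_quadForm δ0 W t
  rw [hlimit]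
  simp only [happrox]
  refine tendsto_iteratedDeriv_quadForm (ι := Fin 6)
    (fun k p q => ε * (M (φ (ψ k)) (p, q) / μ (φ (ψ k)))) (fun p q => polar (W p) (W q))
    (fun k p t => c (φ (ψ k)) p t) (fun p t => c₀ p t) ?_ ?_ ts t₀ ?_ ?_ n
  · intro k p m
    by_cases hp5 : p = 5
    · simp only [hc, hp5, if_true]; exact contDiff_dslope_exp _ _ m
    · by_cases hp4 : p = 4
      · subst hp4
        simp only [hc, hp5, if_false, if_true]
        exact contDiff_dslope_exp _ _ m
      · by_cases hp3 : p = 3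
        · subst hp3
          simp only [hc, hp5, hp4, if_false, if_true]
          exact contDiff_dslope_exp _ _ m
        · simp only [hc, hp5, hp4, hp3, if_false]; exact contDiff_exp_const_mul' _ m
  · intro p m
    by_cases hp5 : p = 5
    · simp only [hc₀, hp5, if_true]; exact contDiff_dslope_exp _ _ m
    · by_cases hp4 : p = 4
      · subst hp4
        simp only [hc₀, hp5, if_false, if_true]
        exact contDiff_dslope_exp _ _ m
      · by_cases hp3 : p = 3
        · subst hp3
          simp only [hc₀, hp5, hp4, if_false, if_true]
          exact contDiff_dslope_exp _ _ m
        · simp only [hc₀, hp5, hp4, hp3, if_false]; exact contDiff_exp_const_mul' _ m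
  · intro p q
    rw [← hcW p q]
    exact ((hcl (p, q)).comp hψ.tendsto_atTop).const_mul ε
  · intro p i
    by_cases hp5 : p = 5
    · simp only [hc, hc₀, hp5, if_true]
      exact tendsto_iteratedDeriv_dslope_exp i ((hδ 0).comp hφψ) (by rw [← h50]; exact (hδ 5).comp hφψ) hts
    · by_cases hp4 : p = 4
      · subst hp4
        simp only [hc, hc₀, hp5, if_false, if_true]
        exact tendsto_iteratedDeriv_dslope_exp i ((hδ 1).comp hφψ) (by rw [← h41]; exact (hδ 4).comp hφψ) hts
      · by_cases hp3 : p = 3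
        · subst hp3
          simp only [hc, hc₀, hp5, hp4, if_false, if_true]
          exact tendsto_iteratedDeriv_dslope_exp i ((hδ 2).comp hφψ) (by rw [← h32]; exact (hδ 3).comp hφψ) hts
        · simp only [hc, hc₀, hp5, hp4, hp3, if_false]
          exact tendsto_iteratedDeriv_exp i ((hδ p).comp hφψ) hts

/-! ## 2. The door-free window theorem at three Weyl pairs -/

/-- **NO TWENTY IN A WINDOW AT A VALUE-GENERIC THREE-WEYL-PAIR POINT — NO DOOR.** [this work] -/
theorem no_twenty_window_threeWeylPairs
    (δs : ℕ → Fin 6 → ℝ) (δ0 : Fin 6 → ℝ) (hδ : ∀ l, Tendsto (fun ν => δs ν l) atTop (𝓝 (δ0 l)))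
    (h50 : δ0 5 = δ0 0) (h41 : δ0 4 = δ0 1) (h32 : δ0 3 = δ0 2)
    (hvg : ∀ a b c e : Fin 3, δ0 a.castSucc.castSucc.castSucc + δ0 b.castSucc.castSucc.castSucc
        = δ0 c.castSucc.castSucc.castSucc + δ0 e.castSucc.castSucc.castSucc → (a = c ∧ b = e) ∨ (a = e ∧ b = c))
    (U : ℕ → Fin 6 → Matrix (Fin 2) (Fin 2) ℝ) (hU : ∀ ν l, (U ν l).IsSymm)
    (hne : ∀ ν, ∃ t, (∑ l, Real.exp (δs ν l * t) • U ν l).det ≠ 0)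
    (A B : ℝ) (hz : ∀ ν, ∃ z : Fin 20 → ℝ, StrictMono z ∧ ∀ i, z i ∈ Set.Icc A B ∧ (∑ l, Real.exp (δs ν l * z i) • U ν l).det = 0) :
    False := by
  obtain ⟨φ, hφ, a, W, hWs, hWne, hconv⟩ := threePairLimit δs δ0 hδ h50 h41 h32 U hU hne
  have hne' := threePairDet_ne_zero_of_polar_ne_zero δ0 h50 h41 h32 hvg W hWs hWne
  -- the three-pair determinant in the `Fin 3`-indexed shape of the count file
  obtain ⟨E, hE⟩ : ∃ E : Fin 3 → ℝ, E = ![δ0 0, δ0 1, δ0 2] := ⟨_, rfl⟩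
  obtain ⟨τ, hτ⟩ : ∃ τ : Fin 3 → Matrix (Fin 2) (Fin 2) ℝ, τ = ![W 0, W 1, W 2] := ⟨_, rfl⟩
  obtain ⟨T, hT⟩ : ∃ T : Fin 3 → Matrix (Fin 2) (Fin 2) ℝ, T = ![W 5, W 4, W 3] := ⟨_, rfl⟩
  have hfun : (fun t : ℝ => (∑ b, (Real.exp (E b * t)) • (τ b + t • T b)).det)
      = (fun t => ((Real.exp (δ0 0 * t)) • (W 0 + t • W 5) + (Real.exp (δ0 1 * t)) • (W 1 + t • W 4)
        + (Real.exp (δ0 2 * t)) • (W 2 + t • W 3)).det) := by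
    funext t
    rw [hE, hτ, hT, Fin.sum_univ_three]
    simp only [Matrix.cons_val_zero, Matrix.cons_val_one, Matrix.head_cons, Matrix.cons_val_two, Matrix.tail_cons]
  obtain ⟨Z, m, hZ, h20⟩ := multiplicity_transfer_iteratedDeriv A B
    (fun k t => a k * (∑ l, Real.exp (δs (φ k) l * t) • U (φ k) l).det)
    (fun t => ((Real.exp (δ0 0 * t)) • (W 0 + t • W 5) + (Real.exp (δ0 1 * t)) • (W 1 + t • W 4)
        + (Real.exp (δ0 2 * t)) • (W 2 + t • W 3)).det)
    (fun k n => contDiff_const.mul (contDiff_pencilDet _ _ n))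
    (fun j _ ψ hψ t t₀ _ ht => hconv j ψ hψ t t₀ ht)
    (fun k => by
      obtain ⟨z, hz1, hz2⟩ := hz (φ k)
      exact ⟨z, hz1, fun i => ⟨(hz2 i).1, by rw [(hz2 i).2, mul_zero]⟩⟩)
  have hfun_t : ∀ t : ℝ, (∑ b, (Real.exp (E b * t)) • (τ b + t • T b)).det
      = ((Real.exp (δ0 0 * t)) • (W 0 + t • W 5) + (Real.exp (δ0 1 * t)) • (W 1 + t • W 4)
        + (Real.exp (δ0 2 * t)) • (W 2 + t • W 3)).det := fun t => congrFun hfun t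
  have hne'' : ∃ t : ℝ, (∑ b, (Real.exp (E b * t)) • (τ b + t • T b)).det ≠ 0 := by
    obtain ⟨t, ht⟩ := hne'
    exact ⟨t, by rw [hfun_t]; exact ht⟩
  have h17 := threePair_count_conclusion E τ T hne'' Z m (fun z hz' j hj => by rw [hfun]; exact (hZ z hz').2 j hj)
  omega

/-- **NO BOUNDED-RATIO TWENTIES NEAR A VALUE-GENERIC THREE-WEYL-PAIR POINT — NO DOOR.** [this work] -/
theorem no_boundedRatio_twenties_threeWeylPairs
    (δ0 : Fin 6 → ℝ) (h50 : δ0 5 = δ0 0) (h41 : δ0 4 = δ0 1) (h32 : δ0 3 = δ0 2)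
    (hvg : ∀ a b c e : Fin 3, δ0 a.castSucc.castSucc.castSucc + δ0 b.castSucc.castSucc.castSucc
        = δ0 c.castSucc.castSucc.castSucc + δ0 e.castSucc.castSucc.castSucc → (a = c ∧ b = e) ∨ (a = e ∧ b = c))
    (δs : ℕ → Fin 6 → ℝ) (hδ : ∀ l, Tendsto (fun ν => δs ν l) atTop (𝓝 (δ0 l)))
    (S : ℕ → Fin 6 → Matrix (Fin 2) (Fin 2) ℝ) (hS : ∀ ν l, (S ν l).IsSymm)
    (hne : ∀ ν, ∃ y : ℝ, 0 < y ∧ (∑ l, (y ^ (δs ν l)) • S ν l).det ≠ 0)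
    (R : ℝ) (x : ℕ → Fin 20 → ℝ) (hx : ∀ ν, StrictMono (x ν)) (hxpos : ∀ ν k, 0 < x ν k)
    (hxR : ∀ ν k, x ν k ≤ R * x ν 0) (hroot : ∀ ν k, (∑ l, (x ν k ^ (δs ν l)) • S ν l).det = 0) : False := by
  have hR : 0 < R := by
    have h1 := hxR 0 0
    have h2 := hxpos 0 0
    nlinarith
  refine no_twenty_window_threeWeylPairs δs δ0 hδ h50 h41 h32 hvg
    (fun ν l => (x ν 0 ^ (δs ν l)) • S ν l) (fun ν l => (hS ν l).smul _) ?_ 0 (Real.log R) ?_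
  · intro ν
    obtain ⟨y, hy, hdet⟩ := hne ν
    refine ⟨Real.log y - Real.log (x ν 0), ?_⟩
    rw [← pencil_log_recenter (δs ν) (S ν) (hxpos ν 0) hy]
    exact hdet
  · intro ν
    refine ⟨fun k => Real.log (x ν k) - Real.log (x ν 0), fun k k' hkk' => ?_, fun k => ⟨⟨?_, ?_⟩, ?_⟩⟩
    · exact sub_lt_sub_right (Real.log_lt_log (hxpos ν k) (hx ν hkk')) _
    · exact sub_nonneg.mpr (Real.log_le_log (hxpos ν 0) ((hx ν).monotone (Fin.zero_le k)))
    · rw [sub_le_iff_le_add, ← Real.log_mul hR.ne' (hxpos ν 0).ne']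
      exact Real.log_le_log (hxpos ν k) (hxR ν k)
    · rw [← pencil_log_recenter (δs ν) (S ν) (hxpos ν 0) (hxpos ν k)]
      exact hroot ν k

end Summit.ValiantsHypothesis.ValiantsHypothesis.Theorems.LacunarySymmetroidMatrixDescartes.WallBubbling
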